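import Mathlib
import Summits.KontsevichZagierPeriods.Zeta5Search.CellKitRays
import HarnessLib

/-!
# ζ(5) search — long classes of the record ray I: the net exponent of `b(n)` by bracket

Cell `pub-zeta5` (HONEST FRAMING: systematic search; no irrationality claim unless certified), typer seat generation 13.
Tool for the record windows near `θ = 1` (`RecShapesM56/52/48`, `RecClassesM56/52/48`), where a residue class has `≈ 41` points:
the net exponent of the record datum `b(n) = n·(41; 17, …, 11) = bLin (11n) (7n) n` at a position `s ≤ 41n` depends only on the
BRACKET `β = ⌊s/n⌋`, on whether `s` is a multiple of `n` (right staircase is left-open), and on the even-centre flag `2s = 41n`: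
`netExp (bRec n) s = brVal β [n ∣ s] + [2s = 41n]` (`netExp_bRec_eq`), with `brVal` the explicit staircase profile
`1 (β ≤ 10), 11 − β (11..16), −6 (17..23), β − 29 (24..29), 1 (β ≥ 30)` (shifted by one bracket at exact multiples on the right).
Integer bookkeeping from `CellKit.depL_*`; nothing here bears on irrationality.
-/

namespace Summit.KontsevichZagierPeriods.Zeta5Search.LongClass

open Finset
open Summit.KontsevichZagierPeriods.Zeta5Search.ClusterValuation (netExp bRec blockCount)
open Summit.KontsevichZagierPeriods.Zeta5Search.CellKit

/-- **The bracket profile of the record ray**: value of `netExp (bRec n)` on the bracket `β = ⌊s/n⌋` (`rz` = "`s` is a multiple of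
`n`", which matters only on the right staircase `24 ≤ β ≤ 30`), without the even-centre term. -/
def brVal (β : ℕ) (rz : Bool) : ℤ :=
  if β ≤ 10 then 1 else if β ≤ 16 then 11 - (β : ℤ) else if β ≤ 23 then -6
  else if rz then (if β ≤ 24 then -6 else if β ≤ 30 then (β : ℤ) - 30 else 1)
  else (if β ≤ 29 then (β : ℤ) - 29 else 1)

/-- The depth profile at an exact multiple `s = βn`, `β ≤ 41`. -/
theorem depth_bRec_mul {n β : ℕ} (hn : 1 ≤ n) (hβ : β ≤ 41) :
    1 - (blockCount (bLin (11 * n) (7 * n) n) (β * n) : ℤ) = brVal β true := by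
  interval_cases β
  · rw [depL_low (by omega)]; norm_num [brVal]
  · rw [depL_low (by omega)]; norm_num [brVal]
  · rw [depL_low (by omega)]; norm_num [brVal]
  · rw [depL_low (by omega)]; norm_num [brVal]
  · rw [depL_low (by omega)]; norm_num [brVal]
  · rw [depL_low (by omega)]; norm_num [brVal]
  · rw [depL_low (by omega)]; norm_num [brVal]
  · rw [depL_low (by omega)]; norm_num [brVal]
  · rw [depL_low (by omega)]; norm_num [brVal]
  · rw [depL_low (by omega)]; norm_num [brVal]
  · rw [depL_low (by omega)]; norm_num [brVal]
  · rw [depL_lower (k := 1) (by norm_num) (by norm_num) (by omega) (by omega)]; norm_num [brVal]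
  · rw [depL_lower (k := 2) (by norm_num) (by norm_num) (by omega) (by omega)]; norm_num [brVal]
  · rw [depL_lower (k := 3) (by norm_num) (by norm_num) (by omega) (by omega)]; norm_num [brVal]
  · rw [depL_lower (k := 4) (by norm_num) (by norm_num) (by omega) (by omega)]; norm_num [brVal]
  · rw [depL_lower (k := 5) (by norm_num) (by norm_num) (by omega) (by omega)]; norm_num [brVal]
  · rw [depL_lower (k := 6) (by norm_num) (by norm_num) (by omega) (by omega)]; norm_num [brVal]
  · rw [depL_well (by omega) (by omega)]; norm_num [brVal]
  · rw [depL_well (by omega) (by omega)]; norm_num [brVal]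
  · rw [depL_well (by omega) (by omega)]; norm_num [brVal]
  · rw [depL_well (by omega) (by omega)]; norm_num [brVal]
  · rw [depL_well (by omega) (by omega)]; norm_num [brVal]
  · rw [depL_well (by omega) (by omega)]; norm_num [brVal]
  · rw [depL_well (by omega) (by omega)]; norm_num [brVal]
  · rw [depL_well (by omega) (by omega)]; norm_num [brVal]
  · rw [depL_upper (k := 6) (by norm_num) (by norm_num) (by omega) (by omega)]; norm_num [brVal]
  · rw [depL_upper (k := 5) (by norm_num) (by norm_num) (by omega) (by omega)]; norm_num [brVal]
  · rw [depL_upper (k := 4) (by norm_num) (by norm_num) (by omega) (by omega)]; norm_num [brVal]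
  · rw [depL_upper (k := 3) (by norm_num) (by norm_num) (by omega) (by omega)]; norm_num [brVal]
  · rw [depL_upper (k := 2) (by norm_num) (by norm_num) (by omega) (by omega)]; norm_num [brVal]
  · rw [depL_upper (k := 1) (by norm_num) (by norm_num) (by omega) (by omega)]; norm_num [brVal]
  · rw [depL_high (by omega)]; norm_num [brVal]
  · rw [depL_high (by omega)]; norm_num [brVal]
  · rw [depL_high (by omega)]; norm_num [brVal]
  · rw [depL_high (by omega)]; norm_num [brVal]
  · rw [depL_high (by omega)]; norm_num [brVal]
  · rw [depL_high (by omega)]; norm_num [brVal]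
  · rw [depL_high (by omega)]; norm_num [brVal]
  · rw [depL_high (by omega)]; norm_num [brVal]
  · rw [depL_high (by omega)]; norm_num [brVal]
  · rw [depL_high (by omega)]; norm_num [brVal]
  · rw [depL_high (by omega)]; norm_num [brVal]

/-- The depth profile strictly inside the bracket `β`: `βn < s < βn + n`, `β ≤ 41`. -/
theorem depth_bRec_not_mul {n β s : ℕ} (hβ : β ≤ 41) (h1 : β * n < s) (h2 : s < β * n + n) :
    1 - (blockCount (bLin (11 * n) (7 * n) n) s : ℤ) = brVal β false := by
  interval_cases β
  · rw [depL_low (by omega)]; norm_num [brVal]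
  · rw [depL_low (by omega)]; norm_num [brVal]
  · rw [depL_low (by omega)]; norm_num [brVal]
  · rw [depL_low (by omega)]; norm_num [brVal]
  · rw [depL_low (by omega)]; norm_num [brVal]
  · rw [depL_low (by omega)]; norm_num [brVal]
  · rw [depL_low (by omega)]; norm_num [brVal]
  · rw [depL_low (by omega)]; norm_num [brVal]
  · rw [depL_low (by omega)]; norm_num [brVal]
  · rw [depL_low (by omega)]; norm_num [brVal]
  · rw [depL_low (by omega)]; norm_num [brVal]
  · rw [depL_lower (k := 1) (by norm_num) (by norm_num) (by omega) (by omega)]; norm_num [brVal]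
  · rw [depL_lower (k := 2) (by norm_num) (by norm_num) (by omega) (by omega)]; norm_num [brVal]
  · rw [depL_lower (k := 3) (by norm_num) (by norm_num) (by omega) (by omega)]; norm_num [brVal]
  · rw [depL_lower (k := 4) (by norm_num) (by norm_num) (by omega) (by omega)]; norm_num [brVal]
  · rw [depL_lower (k := 5) (by norm_num) (by norm_num) (by omega) (by omega)]; norm_num [brVal]
  · rw [depL_lower (k := 6) (by norm_num) (by norm_num) (by omega) (by omega)]; norm_num [brVal]
  · rw [depL_well (by omega) (by omega)]; norm_num [brVal]
  · rw [depL_well (by omega) (by omega)]; norm_num [brVal]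
  · rw [depL_well (by omega) (by omega)]; norm_num [brVal]
  · rw [depL_well (by omega) (by omega)]; norm_num [brVal]
  · rw [depL_well (by omega) (by omega)]; norm_num [brVal]
  · rw [depL_well (by omega) (by omega)]; norm_num [brVal]
  · rw [depL_well (by omega) (by omega)]; norm_num [brVal]
  · rw [depL_upper (k := 6) (by norm_num) (by norm_num) (by omega) (by omega)]; norm_num [brVal]
  · rw [depL_upper (k := 5) (by norm_num) (by norm_num) (by omega) (by omega)]; norm_num [brVal]
  · rw [depL_upper (k := 4) (by norm_num) (by norm_num) (by omega) (by omega)]; norm_num [brVal]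
  · rw [depL_upper (k := 3) (by norm_num) (by norm_num) (by omega) (by omega)]; norm_num [brVal]
  · rw [depL_upper (k := 2) (by norm_num) (by norm_num) (by omega) (by omega)]; norm_num [brVal]
  · rw [depL_upper (k := 1) (by norm_num) (by norm_num) (by omega) (by omega)]; norm_num [brVal]
  · rw [depL_high (by omega)]; norm_num [brVal]
  · rw [depL_high (by omega)]; norm_num [brVal]
  · rw [depL_high (by omega)]; norm_num [brVal]
  · rw [depL_high (by omega)]; norm_num [brVal]
  · rw [depL_high (by omega)]; norm_num [brVal]
  · rw [depL_high (by omega)]; norm_num [brVal]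
  · rw [depL_high (by omega)]; norm_num [brVal]
  · rw [depL_high (by omega)]; norm_num [brVal]
  · rw [depL_high (by omega)]; norm_num [brVal]
  · rw [depL_high (by omega)]; norm_num [brVal]
  · rw [depL_high (by omega)]; norm_num [brVal]
  · rw [depL_high (by omega)]; norm_num [brVal]

/-- **`netExp (bRec n) s = brVal ⌊s/n⌋ [n ∣ s] + [2s = 41n]`** for `s ≤ 41n`, `n ≥ 1`. -/
theorem netExp_bRec_eq {n s : ℕ} (hn : 1 ≤ n) (hs : s ≤ 41 * n) :
    netExp (bRec n) s = brVal (s / n) (decide (s % n = 0)) + (if 2 * s = 41 * n then 1 else 0) := by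
  rw [bRec_eq_bLin, netExp_bLin]
  have hcen : (2 * s = 2 * (11 * n) + 12 * n + 7 * n) ↔ (2 * s = 41 * n) := by omega
  simp only [hcen]
  congr 1
  have hmod : n * (s / n) + s % n = s := Nat.div_add_mod s n
  have hlt : s % n < n := Nat.mod_lt s (by omega)
  have hβ : s / n ≤ 41 := by
    apply Nat.div_le_of_le_mul; linarith
  generalize hb : s / n = β at hmod hβ
  rcases Nat.eq_zero_or_pos (s % n) with hr | hr
  · have hsn : s = β * n := by nlinarith [hmod]
    rw [hr, hsn]
    simpa using depth_bRec_mul hn hβ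
  · have hdec : decide (s % n = 0) = false := by rw [decide_eq_false_iff_not]; omega
    rw [hdec]
    exact depth_bRec_not_mul hβ (by nlinarith [hmod]) (by nlinarith [hmod])

end Summit.KontsevichZagierPeriods.Zeta5Search.LongClass
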